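import Summits.HodgeConjecture.HodgeConjecture.Theorems.NikulinTwinTransportRealMultiplicationAnchorOfAlgebraic

/-!
# `TwinTransportRMPicardTwo` (stmt-HodgeConjecture-15067) · Negative · algebra of the `e`-block:
# `NS ∩ NS^⊥ = 0` and `e(NS^⊥) ⊆ NS^⊥` are forced by (eNS)+(e²) alone

Small-model / hygiene facts for the crux `TwinTransportRMPicardTwo` (route NikulinTwinTransport r3),
whose hypotheses posit an endomorphism `e` of `H²(S(ℂ); ℂ)` with (eNS) `e d = 0` for
`d ∈ NS := algebraicClasses S 1` and (e²) `e (e x) = 2 • x` for every `x ⊥ NS`.  The item docstring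
derives "`e` preserves `T = NS^⊥`" from the irreducibility of the transcendental Hodge structure;
ON THE TREE'S CARRIERS no Hodge theory is needed:

* `algebraicClass_perp_eq_zero_of_eBlock` — (eNS)+(e²) force `NS ∩ NS^⊥ = 0` on ANY `ℂ`-scheme
  (`2 • d = e (e d) = e 0 = 0`); in particular the `e`-block is unsatisfiable wherever the cup form
  degenerates on `NS`, and it silently contains the Hodge-index non-degeneracy it needs.
* `eBlock_map_mem_perp` — granted the four named facts behind `exists_nsProjection` (markings,
  `N¹ ⊆ F¹`, Hodge index, `CupPreservesHodgeType 2 S`), (eNS)+(e²) force `e (NS^⊥) ⊆ NS^⊥` on every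
  projective K3 surface: with `π = π_N`, `e x = π(e x) + (e x − π(e x))`, and
  `2 • e x = e (e (e x)) = e (e w) = 2 • w` for `w = e x − π (e x) ∈ NS^⊥`.
* `eBlock_sq_smul_on_perp` — hence `e` restricts to an endomorphism `J` of `NS^⊥` with `J ∘ J = 2`,
  stated pointwise: `e (e (e x)) = 2 • e x` on `NS^⊥`.

So the `e`-block is exactly the datum "`J ∈ End(NS^⊥)`, `J² = 2`, extended by `0`", which is what
the companion files `WithoutRationalityClause` (p98771) / `WithoutTypeClause` exploit.
Refuter seat refuter-cdisprove-stmt-HodgeConjecture-15067-0 (gen 1), 2026-08-16; work file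
`Cruxes/TwinTransportRMPicardTwo/Disproof.lean` §A.
-/

noncomputable section

namespace Summit.HodgeConjecture.HodgeConjecture.Theorems.TwinTransportRMPicardTwo.Negative

open scoped Manifold
open CategoryTheory MonoidalCategory SemiCartesianMonoidalCategory
open Literature.AlgebraicGeometry.Motives Literature.AlgebraicGeometry.HodgeTheory
open Literature.AlgebraicGeometry.Surfaces Literature.Geometry.Kaehler
open Literature.AlgebraicTopology.SingularHomology
open Summit.HodgeConjecture.HodgeConjecture.Theorems.NikulinTwinTransport

/-- **(eNS)+(e²) force `NS ∩ NS^⊥ = 0`** on any `ℂ`-scheme `S`: a class `d ∈ algebraicClasses S 1`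
orthogonal to all of `algebraicClasses S 1` satisfies `2 • d = e (e d) = e 0 = 0`. [folklore] -/
theorem algebraicClass_perp_eq_zero_of_eBlock {S : SchemeOver ℂ}
    (e : complexBetti S (2 * 1) →ₗ[ℂ] complexBetti S (2 * 1))
    (he_N : ∀ d ∈ algebraicClasses S 1, e d = 0)
    (he_T : ∀ x : complexBetti S (2 * 1),
      (∀ d ∈ algebraicClasses S 1, cupProduct (rfl : 2 * 1 + 2 * 1 = 2 * 2) x d = 0) →
        e (e x) = (2 : ℂ) • x)
    {d : complexBetti S (2 * 1)} (hd : d ∈ algebraicClasses S 1)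
    (hperp : ∀ d' ∈ algebraicClasses S 1, cupProduct (rfl : 2 * 1 + 2 * 1 = 2 * 2) d d' = 0) :
    d = 0 := by
  have h := he_T d hperp
  rw [he_N d hd, map_zero] at h
  exact (smul_eq_zero.mp h.symm).resolve_left two_ne_zero

/-- **(eNS)+(e²) force `e (NS^⊥) ⊆ NS^⊥`** on a projective K3 surface, granted markings,
`N¹ ⊆ F¹`, the Hodge index theorem for `S` and `CupPreservesHodgeType 2 S` (which give the projection
`π_N` onto `NS` along `NS^⊥`, `exists_nsProjection`): no irreducibility of `T(S)`, no rationality and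
no Hodge types of `e` are used. [folklore] -/
theorem eBlock_map_mem_perp (hmark : Huybrechts_K3_marking_exists)
    (hG : Grothendieck1969_supportedClasses_le_hodgeConiveau) {S : SchemeOver ℂ} (hS : IsK3Surface S)
    (hHI : hodgeIndex_surface S) (hcupS : CupPreservesHodgeType 2 S)
    (e : complexBetti S (2 * 1) →ₗ[ℂ] complexBetti S (2 * 1))
    (he_N : ∀ d ∈ algebraicClasses S 1, e d = 0)
    (he_T : ∀ x : complexBetti S (2 * 1),
      (∀ d ∈ algebraicClasses S 1, cupProduct (rfl : 2 * 1 + 2 * 1 = 2 * 2) x d = 0) →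
        e (e x) = (2 : ℂ) • x)
    {x : complexBetti S (2 * 1)}
    (hx : ∀ d ∈ algebraicClasses S 1, cupProduct (rfl : 2 * 1 + 2 * 1 = 2 * 2) x d = 0) :
    ∀ d ∈ algebraicClasses S 1, cupProduct (rfl : 2 * 1 + 2 * 1 = 2 * 2) (e x) d = 0 := by
  obtain ⟨η, p₀, x₀, hp₀, ⟨-, -, hηint, hηcup, -, -⟩, -⟩ := hmark S hS
  obtain ⟨A⟩ := hS.nonempty_hodgeModel
  have hN11 : ∀ d ∈ algebraicClasses S 1, IsOfHodgeType 2 S (2 * 1) 1 1 d :=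
    fun d hd => isOfHodgeType_oneOne_of_mem_algebraicClasses hG hS hd
  obtain ⟨π, hπN, -, -, hπperp, -, -⟩ :=
    exists_nsProjection hS η hp₀ hηint hηcup hHI A hcupS hN11
  -- decompose `e x = n + w`, `n = π (e x) ∈ NS`, `w = e x - π (e x) ∈ NS^⊥`
  have hw : ∀ d ∈ algebraicClasses S 1,
      cupProduct (rfl : 2 * 1 + 2 * 1 = 2 * 2) (e x - π (e x)) d = 0 := hπperp (e x)
  have h1 : e (e x) = e (e x - π (e x)) := by
    rw [map_sub, he_N _ (hπN (e x)), sub_zero]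
  -- `2 • e x = e (e (e x)) = e (e w) = 2 • w`
  have h2 : (2 : ℂ) • e x = (2 : ℂ) • (e x - π (e x)) := by
    rw [← map_smul, ← he_T x hx, h1, he_T _ hw]
  have h3 : e x = e x - π (e x) := smul_right_injective _ (two_ne_zero (α := ℂ)) h2
  rw [h3]
  exact hw

/-- **Hence `e³ = 2e` on `NS^⊥`**: `e` restricts to an endomorphism `J` of `NS^⊥` with `J ∘ J = 2`
(pointwise form, same facts as `eBlock_map_mem_perp`). [folklore] -/
theorem eBlock_sq_smul_on_perp (hmark : Huybrechts_K3_marking_exists)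
    (hG : Grothendieck1969_supportedClasses_le_hodgeConiveau) {S : SchemeOver ℂ} (hS : IsK3Surface S)
    (hHI : hodgeIndex_surface S) (hcupS : CupPreservesHodgeType 2 S)
    (e : complexBetti S (2 * 1) →ₗ[ℂ] complexBetti S (2 * 1))
    (he_N : ∀ d ∈ algebraicClasses S 1, e d = 0)
    (he_T : ∀ x : complexBetti S (2 * 1),
      (∀ d ∈ algebraicClasses S 1, cupProduct (rfl : 2 * 1 + 2 * 1 = 2 * 2) x d = 0) →
        e (e x) = (2 : ℂ) • x)
    {x : complexBetti S (2 * 1)}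
    (hx : ∀ d ∈ algebraicClasses S 1, cupProduct (rfl : 2 * 1 + 2 * 1 = 2 * 2) x d = 0) :
    e (e (e x)) = (2 : ℂ) • e x :=
  he_T (e x) (eBlock_map_mem_perp hmark hG hS hHI hcupS e he_N he_T hx)

end Summit.HodgeConjecture.HodgeConjecture.Theorems.TwinTransportRMPicardTwo.Negative

end
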